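import Literature.NumberTheory.LFunctions.KMVCutoffW
import Literature.Analysis.SpecialFunctions.GammaVerticalBounds
import Literature.Barriers.RiemannHypothesis.DavenportHeilbronnHamburgerTools
import Mathlib.Analysis.MellinInversion
import Mathlib.Analysis.SpecialFunctions.Gaussian.GaussianIntegral
import HarnessLib

/-!
# KMV's cut-off `W`: the Mellin pair `𝓜W(s) = Γ(s)Γ(1+s)` and
# `W(y) = (1/2πi) ∫_{(σ)} Γ(t)Γ(1+t) y^{−t} dt` (`σ > 0`)

Source: E. Kowalski, P. Michel, J. VanderKam, *Non-vanishing of high derivatives of automorphic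
`L`-functions at the center of the critical strip*, J. reine angew. Math. 526 (2000), (21) p. 12
[held: paper:doi-10-1515-crll-2000-074]: `W(y) = (1/2πi) ∫_{(3)} Γ(1+t)² y^{−t} dt/t`.
Cell landau-siegel / ls-inputs, row H-AFE (INPUT LIST v1.4.1 G2-2, item (B) «the Mellin pair»),
seat ls-inputs-Hafe-w1 g0 (worker of ls-inputs-Hafe-lead). Proofs only (no definitions, no named facts).

For the tree's closed real form `KMV2000.cutoffW y = ∫_0^∞ e^{−u−y/u} du` (statement file
`KMVCentralValueSquaredAFE`, p624193) this file PROVES: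

* `KMV2000.mellin_cutoffW`: `∫_0^∞ W(y) y^{s−1} dy = Γ(s) Γ(s+1)` for `Re s > 0`, together with
  `KMV2000.mellinConvergent_cutoffW` (absolute convergence). PROOF: Fubini on `(0,∞)²` for
  `(y, u) ↦ y^{s−1} e^{−u−y/u}` (its norm integrates to `Γ(σ)Γ(σ+1)`, `σ = Re s`), then
  `∫_0^∞ y^{s−1} e^{−y/u} dy = Γ(s) u^s` and `∫_0^∞ e^{−u} u^s du = Γ(s+1)`.
* `KMV2000.continuousAt_cutoffW`: `W` is continuous at every `y > 0` (dominated convergence).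
* `KMV2000.integrable_Gamma_mul_Gamma_add_one_vertical`: `y ↦ Γ(σ+iy)Γ(σ+1+iy)` is integrable
  for `σ > 0` (the tree's `integrable_Gamma_vertical_of_pos` and `|Γ(σ+1+iy)| ≤ Γ(σ+1)`).
* `KMV2000.cutoffW_eq_mellinInv`: **Mellin inversion** `W(y) = (1/2πi)∫_{(σ)} Γ(t)Γ(1+t) y^{−t} dt`
  for every `σ > 0`, `y > 0` (Mathlib `mellinInv_mellin_eq`), also in the explicit form
  `W(y) = (1/2π) ∫_ℝ y^{−(σ+iv)} Γ(σ+iv)Γ(σ+1+iv) dv`; since `Γ(t)Γ(1+t) = Γ(1+t)²/t` this is the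
  printed (21) (at `σ = 3`), see the companion bridge file `KMVCutoffWAfeWBridge`
  (`afeW q̂ 0 0 n₁ n₂ = W(n₁n₂/q̂²)`).

* `KMV2000.cutoffW_eq_integral_Ioi_integral_Ioi` (appended): the double-integral form
  `W(y) = ∫_{v>y} ∫_{u>0} e^{−u−v/u} u⁻¹ du dv` (`y ≥ 0`), i.e. the crux sketch's `kmvW`.

No moments, no `L`-functions; no claim about Landau–Siegel zeros.
-/

noncomputable section

open scoped Real
open Complex Set MeasureTheory Filter
open _root_.Topology

namespace Literature.NumberTheory.LFunctions.KMV2000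

/-! ### The two-variable integrand `(y, u) ↦ y^{s−1} e^{−u−y/u}` on `(0,∞)²` -/

/-- Norm of the integrand: `‖y^{s−1} e^{−u−y/u}‖ = y^{Re s − 1} e^{−u−y/u}` for `y > 0`.
[cite: KowalskiMichelVanderKam2000, (21) p. 12] -/
theorem norm_cpow_mul_exp_neg_sub_div {y : ℝ} (hy : 0 < y) (u : ℝ) (s : ℂ) :
    ‖(y : ℂ) ^ (s - 1) * ((Real.exp (-u - y / u) : ℝ) : ℂ)‖ =
      y ^ (s.re - 1) * Real.exp (-u - y / u) := by
  rw [norm_mul, Complex.norm_cpow_eq_rpow_re_of_pos hy, Complex.norm_real,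
    Real.norm_of_nonneg (Real.exp_pos _).le, sub_re, one_re]

/-- The integrand is continuous on the open quadrant `(0,∞)²`.
[cite: KowalskiMichelVanderKam2000, (21) p. 12] -/
theorem continuousOn_cpow_mul_exp_neg_sub_div (s : ℂ) :
    ContinuousOn (fun p : ℝ × ℝ ↦ (p.1 : ℂ) ^ (s - 1) * ((Real.exp (-p.2 - p.1 / p.2) : ℝ) : ℂ))
      (Ioi 0 ×ˢ Ioi 0) := by
  intro p hp
  have hp1 : 0 < p.1 := hp.1
  have hp2 : p.2 ≠ 0 := ne_of_gt hp.2
  refine ContinuousAt.continuousWithinAt (ContinuousAt.mul ?_ ?_)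
  · exact (continuousAt_ofReal_cpow_const p.1 (s - 1) (Or.inr hp1.ne')).comp
      continuous_fst.continuousAt
  · have h : ContinuousAt (fun p : ℝ × ℝ ↦ -p.2 - p.1 / p.2) p :=
      continuous_snd.continuousAt.neg.sub
        (continuous_fst.continuousAt.div continuous_snd.continuousAt hp2)
    exact continuous_ofReal.continuousAt.comp (Real.continuous_exp.continuousAt.comp h)

/-- The integrand is a.e.-strongly measurable for the product of the Lebesgue measures on `(0,∞)`.
[cite: KowalskiMichelVanderKam2000, (21) p. 12] -/
theorem aestronglyMeasurable_cpow_mul_exp_neg_sub_div (s : ℂ) :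
    AEStronglyMeasurable
      (fun p : ℝ × ℝ ↦ (p.1 : ℂ) ^ (s - 1) * ((Real.exp (-p.2 - p.1 / p.2) : ℝ) : ℂ))
      ((volume.restrict (Ioi (0 : ℝ))).prod (volume.restrict (Ioi (0 : ℝ)))) := by
  rw [Measure.prod_restrict, ← Measure.volume_eq_prod]
  exact (continuousOn_cpow_mul_exp_neg_sub_div s).aestronglyMeasurable
    (measurableSet_Ioi.prod measurableSet_Ioi)

/-- For fixed `u > 0`, `y ↦ y^{s−1} e^{−u−y/u}` is integrable on `(0,∞)` when `Re s > 0`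
(a Gamma integral). [cite: KowalskiMichelVanderKam2000, (21) p. 12] -/
theorem integrableOn_cpow_mul_exp_neg_sub_div {s : ℂ} (hs : 0 < s.re) {u : ℝ} (hu : 0 < u) :
    IntegrableOn (fun y : ℝ ↦ (y : ℂ) ^ (s - 1) * ((Real.exp (-u - y / u) : ℝ) : ℂ)) (Ioi 0) := by
  have hb : IntegrableOn (fun y : ℝ ↦ Real.exp (-u) * (y ^ (s.re - 1) * Real.exp (-u⁻¹ * y)))
      (Ioi 0) := by
    have h := integrableOn_rpow_mul_exp_neg_mul_rpow (s := s.re - 1) (p := 1) (b := u⁻¹)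
      (by linarith) le_rfl (inv_pos.mpr hu)
    refine (h.congr_fun (fun y _ ↦ ?_) measurableSet_Ioi).const_mul (Real.exp (-u))
    simp only [Real.rpow_one]
  have hcont : ContinuousOn (fun y : ℝ ↦ (y : ℂ) ^ (s - 1) * ((Real.exp (-u - y / u) : ℝ) : ℂ))
      (Ioi 0) := by
    refine ContinuousOn.mul (fun y hy ↦ ?_) (Continuous.continuousOn (by fun_prop))
    exact (continuousAt_ofReal_cpow_const y (s - 1) (Or.inr (ne_of_gt hy))).continuousWithinAt
  refine Integrable.mono' hb (hcont.aestronglyMeasurable measurableSet_Ioi) ?_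
  refine (ae_restrict_iff' measurableSet_Ioi).mpr (ae_of_all _ fun y hy ↦ ?_)
  rw [norm_cpow_mul_exp_neg_sub_div hy, show -u - y / u = -u + -u⁻¹ * y by ring, Real.exp_add]
  ring_nf
  rfl

/-- For `u > 0` and `σ > 0`: `∫_0^∞ y^{σ−1} e^{−u−y/u} dy = Γ(σ) · e^{−u} u^{σ}`.
[cite: KowalskiMichelVanderKam2000, (21) p. 12] -/
theorem integral_rpow_mul_exp_neg_sub_div {σ : ℝ} (hσ : 0 < σ) {u : ℝ} (hu : 0 < u) :
    ∫ y in Ioi (0 : ℝ), y ^ (σ - 1) * Real.exp (-u - y / u) =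
      Real.Gamma σ * (Real.exp (-u) * u ^ σ) := by
  have h := Real.integral_rpow_mul_exp_neg_mul_Ioi hσ (inv_pos.mpr hu)
  have h2 : ∫ y in Ioi (0 : ℝ), y ^ (σ - 1) * Real.exp (-u - y / u) =
      Real.exp (-u) * ∫ y in Ioi (0 : ℝ), y ^ (σ - 1) * Real.exp (-(u⁻¹ * y)) := by
    rw [← integral_const_mul]
    refine setIntegral_congr_fun measurableSet_Ioi fun y _ ↦ ?_
    rw [show -u - y / u = -u + -(u⁻¹ * y) by ring, Real.exp_add]
    ring
  rw [h2, h, one_div, inv_inv]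
  ring

/-- The norm of the integrand integrates (in `y`) to `Γ(σ) e^{−u} u^σ`, `σ = Re s`, for `u > 0`.
[cite: KowalskiMichelVanderKam2000, (21) p. 12] -/
theorem integral_norm_cpow_mul_exp_neg_sub_div {s : ℂ} (hs : 0 < s.re) {u : ℝ} (hu : 0 < u) :
    ∫ y in Ioi (0 : ℝ), ‖(y : ℂ) ^ (s - 1) * ((Real.exp (-u - y / u) : ℝ) : ℂ)‖ =
      Real.Gamma s.re * (Real.exp (-u) * u ^ s.re) := by
  rw [← integral_rpow_mul_exp_neg_sub_div hs hu]
  exact setIntegral_congr_fun measurableSet_Ioi fun y hy ↦ norm_cpow_mul_exp_neg_sub_div hy u s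

/-- **Absolute convergence of the double integral**: `(y, u) ↦ y^{s−1} e^{−u−y/u}` is integrable on
`(0,∞)²` for `Re s > 0` (Tonelli: `∫∫ |·| = Γ(σ) ∫_0^∞ e^{−u} u^σ du = Γ(σ)Γ(σ+1)`).
[cite: KowalskiMichelVanderKam2000, (21) p. 12] -/
theorem integrable_cpow_mul_exp_neg_sub_div_prod {s : ℂ} (hs : 0 < s.re) :
    Integrable (fun p : ℝ × ℝ ↦ (p.1 : ℂ) ^ (s - 1) * ((Real.exp (-p.2 - p.1 / p.2) : ℝ) : ℂ))
      ((volume.restrict (Ioi (0 : ℝ))).prod (volume.restrict (Ioi (0 : ℝ)))) := by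
  refine (integrable_prod_iff' (aestronglyMeasurable_cpow_mul_exp_neg_sub_div s)).mpr ⟨?_, ?_⟩
  · exact (ae_restrict_iff' measurableSet_Ioi).mpr
      (ae_of_all _ fun u hu ↦ integrableOn_cpow_mul_exp_neg_sub_div hs hu)
  · have hG : IntegrableOn (fun u : ℝ ↦ Real.Gamma s.re * (Real.exp (-u) * u ^ s.re)) (Ioi 0) := by
      have h := Real.GammaIntegral_convergent (s := s.re + 1) (by linarith)
      simp only [add_sub_cancel_right] at h
      exact h.const_mul _
    refine hG.congr_fun (fun u hu ↦ ?_) measurableSet_Ioi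
    exact (integral_norm_cpow_mul_exp_neg_sub_div hs hu).symm

/-! ### The Mellin transform `𝓜W(s) = Γ(s)Γ(s+1)` -/

/-- For `y > 0`: `y^{s−1} · W(y) = ∫_0^∞ y^{s−1} e^{−u−y/u} du` (the constant pulled inside).
[cite: KowalskiMichelVanderKam2000, (21) p. 12] -/
theorem cpow_smul_cutoffW_eq_integral (s : ℂ) (y : ℝ) :
    (y : ℂ) ^ (s - 1) • ((cutoffW y : ℝ) : ℂ) =
      ∫ u in Ioi (0 : ℝ), (y : ℂ) ^ (s - 1) * ((Real.exp (-u - y / u) : ℝ) : ℂ) := by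
  rw [cutoffW, smul_eq_mul, ← integral_complex_ofReal, ← integral_const_mul]

/-- **The Mellin transform of KMV's cut-off**: `∫_0^∞ W(y) y^{s−1} dy = Γ(s) Γ(s+1)` for `Re s > 0`
(`= Γ(1+s)²/s`, the Mellin–Barnes kernel of (21)). [cite: KowalskiMichelVanderKam2000, (21) p. 12] -/
theorem mellin_cutoffW {s : ℂ} (hs : 0 < s.re) :
    mellin (fun y : ℝ ↦ ((cutoffW y : ℝ) : ℂ)) s = Complex.Gamma s * Complex.Gamma (s + 1) := by
  rw [mellin, setIntegral_congr_fun measurableSet_Ioi (fun y _ ↦ cpow_smul_cutoffW_eq_integral s y)]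
  have hswap := integral_integral_swap
    (f := fun (y u : ℝ) ↦ (y : ℂ) ^ (s - 1) * ((Real.exp (-u - y / u) : ℝ) : ℂ))
    (μ := volume.restrict (Ioi (0 : ℝ))) (ν := volume.restrict (Ioi (0 : ℝ)))
    (integrable_cpow_mul_exp_neg_sub_div_prod hs)
  rw [hswap]
  have hinner : ∀ u ∈ Ioi (0 : ℝ),
      ∫ y in Ioi (0 : ℝ), (y : ℂ) ^ (s - 1) * ((Real.exp (-u - y / u) : ℝ) : ℂ) =
        ((Real.exp (-u) : ℝ) : ℂ) * (u : ℂ) ^ (s + 1 - 1) * Complex.Gamma s := by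
    intro u hu
    have hu0 : (0 : ℝ) < u := hu
    have hpt : ∀ y ∈ Ioi (0 : ℝ), (y : ℂ) ^ (s - 1) * ((Real.exp (-u - y / u) : ℝ) : ℂ) =
        ((Real.exp (-u) : ℝ) : ℂ) * ((y : ℂ) ^ (s - 1) * Complex.exp (-((u⁻¹ : ℝ) * (y : ℂ)))) := by
      intro y _
      rw [show -u - y / u = -u + -(u⁻¹ * y) by ring, Real.exp_add]
      push_cast
      ring
    rw [setIntegral_congr_fun measurableSet_Ioi hpt, integral_const_mul,
      Complex.integral_cpow_mul_exp_neg_mul_Ioi hs (inv_pos.mpr hu0)]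
    have h1 : (1 / ((u⁻¹ : ℝ) : ℂ)) = (u : ℂ) := by
      push_cast
      rw [one_div, inv_inv]
    rw [h1, add_sub_cancel_right]
    ring
  rw [setIntegral_congr_fun measurableSet_Ioi hinner, integral_mul_const,
    Complex.Gamma_eq_integral (s := s + 1) (by simp only [add_re, one_re]; linarith),
    Complex.GammaIntegral]
  ring

/-- **Absolute convergence of the Mellin transform** of `W` for `Re s > 0`.
[cite: KowalskiMichelVanderKam2000, (21)–(22) p. 12] -/
theorem mellinConvergent_cutoffW {s : ℂ} (hs : 0 < s.re) :
    MellinConvergent (fun y : ℝ ↦ ((cutoffW y : ℝ) : ℂ)) s := by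
  have h := (integrable_cpow_mul_exp_neg_sub_div_prod hs).integral_prod_left
  refine IntegrableOn.congr_fun h (fun y _ ↦ ?_) measurableSet_Ioi
  exact (cpow_smul_cutoffW_eq_integral s y).symm

/-! ### Continuity of `W` on `(0, ∞)` -/

/-- `W` is continuous at every `y > 0` (dominated convergence, majorant `e^{−u}`).
[cite: KowalskiMichelVanderKam2000, (21) p. 12] -/
theorem continuousAt_cutoffW {x : ℝ} (hx : 0 < x) : ContinuousAt cutoffW x := by
  have hev : ∀ᶠ y in 𝓝 x, 0 < y := Ioi_mem_nhds hx
  show ContinuousAt (fun y : ℝ ↦ ∫ u in Ioi (0 : ℝ), Real.exp (-u - y / u)) x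
  refine continuousAt_of_dominated (bound := fun u : ℝ ↦ Real.exp (-u)) ?_ ?_
    integrableOn_exp_neg_Ioi ?_
  · filter_upwards [hev] with y _
    exact (continuousOn_exp_neg_sub_div y).aestronglyMeasurable measurableSet_Ioi
  · filter_upwards [hev] with y hy
    refine (ae_restrict_iff' measurableSet_Ioi).mpr (ae_of_all _ fun u hu ↦ ?_)
    rw [Real.norm_of_nonneg (Real.exp_pos _).le]
    exact exp_neg_sub_div_le hy.le hu
  · refine (ae_restrict_iff' measurableSet_Ioi).mpr (ae_of_all _ fun u _ ↦ ?_)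
    exact (Real.continuous_exp.comp (by fun_prop)).continuousAt

/-! ### Vertical integrability of `Γ(t)Γ(1+t)` and Mellin inversion -/

/-- `y ↦ Γ(σ + 1 + iy)` is continuous for `σ > 0` (no poles on the line).
[cite: KowalskiMichelVanderKam2000, (21) p. 12] -/
theorem continuous_Gamma_add_one_vertical {σ : ℝ} (hσ : 0 < σ) :
    Continuous fun y : ℝ ↦ Complex.Gamma (σ + y * I + 1) := by
  refine continuous_iff_continuousAt.2 fun y ↦ ?_
  have hΓ : DifferentiableAt ℂ Complex.Gamma ((σ : ℂ) + y * I + 1) := by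
    refine Complex.differentiableAt_Gamma _ fun m h ↦ ?_
    have h1 := congrArg Complex.re h
    simp only [add_re, ofReal_re, mul_re, I_re, mul_zero, ofReal_im, I_im, mul_one, sub_self,
      add_zero, one_re, neg_re, natCast_re] at h1
    linarith [m.cast_nonneg (α := ℝ)]
  have hc : Continuous fun y : ℝ ↦ (σ : ℂ) + y * I + 1 := by fun_prop
  exact ContinuousAt.comp (f := fun y : ℝ ↦ (σ : ℂ) + y * I + 1) (g := Complex.Gamma)
    hΓ.continuousAt hc.continuousAt

/-- **`y ↦ Γ(σ+iy) Γ(σ+1+iy)` is integrable on `ℝ`** for every `σ > 0` (`Γ(σ+iy)` is integrable —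
the tree's `integrable_Gamma_vertical_of_pos` — and `|Γ(σ+1+iy)| ≤ Γ(σ+1)`).
[cite: KowalskiMichelVanderKam2000, (21)–(22) p. 12] -/
theorem integrable_Gamma_mul_Gamma_add_one_vertical {σ : ℝ} (hσ : 0 < σ) :
    Integrable fun y : ℝ ↦ Complex.Gamma (σ + y * I) * Complex.Gamma (σ + y * I + 1) := by
  have hg := Literature.Barriers.RiemannHypothesis.Hamburger1921.integrable_Gamma_vertical_of_pos hσ
  refine hg.mul_bdd (c := Real.Gamma (σ + 1))
    (continuous_Gamma_add_one_vertical hσ).aestronglyMeasurable (ae_of_all _ fun y ↦ ?_)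
  have h := Literature.Analysis.SpecialFunctions.GammaVert.norm_Gamma_le_Gamma_re
    (x := σ + 1) (by linarith) y
  push_cast at h
  rwa [show (σ : ℂ) + y * I + 1 = σ + 1 + y * I by ring]

/-- The Mellin transform of `W` is integrable on every vertical line `Re t = σ > 0`.
[cite: KowalskiMichelVanderKam2000, (21)–(22) p. 12] -/
theorem verticalIntegrable_mellin_cutoffW {σ : ℝ} (hσ : 0 < σ) :
    Complex.VerticalIntegrable (mellin fun y : ℝ ↦ ((cutoffW y : ℝ) : ℂ)) σ := by
  rw [Complex.VerticalIntegrable]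
  refine (integrable_Gamma_mul_Gamma_add_one_vertical hσ).congr (ae_of_all _ fun y ↦ ?_)
  simp only
  rw [mellin_cutoffW]
  simp only [add_re, ofReal_re, mul_re, I_re, mul_zero, ofReal_im, I_im, mul_one, sub_self,
    add_zero]
  exact hσ

/-- **Mellin inversion for KMV's cut-off**: `W(y) = (1/2πi) ∫_{(σ)} Γ(t) Γ(1+t) y^{−t} dt` for every
`σ > 0` and `y > 0` (Mathlib's `mellinInv`; `Γ(t)Γ(1+t) = Γ(1+t)²/t` is the kernel of (21)).
[cite: KowalskiMichelVanderKam2000, (21) p. 12] -/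
theorem cutoffW_eq_mellinInv {σ : ℝ} (hσ : 0 < σ) {y : ℝ} (hy : 0 < y) :
    ((cutoffW y : ℝ) : ℂ) =
      mellinInv σ (fun t : ℂ ↦ Complex.Gamma t * Complex.Gamma (t + 1)) y := by
  have h := mellinInv_mellin_eq σ (fun t : ℝ ↦ ((cutoffW t : ℝ) : ℂ)) hy
    (mellinConvergent_cutoffW (by simpa using hσ)) (verticalIntegrable_mellin_cutoffW hσ)
    (continuous_ofReal.continuousAt.comp (continuousAt_cutoffW hy))
  rw [← h, mellinInv, mellinInv]
  congr 1
  refine integral_congr_ae (ae_of_all _ fun v ↦ ?_)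
  simp only
  rw [mellin_cutoffW]
  simp only [add_re, ofReal_re, mul_re, I_re, mul_zero, ofReal_im, I_im, mul_one, sub_self,
    add_zero]
  exact hσ

/-- Mellin inversion in explicit form: for `σ > 0`, `y > 0`,
`W(y) = (1/2π) ∫_ℝ y^{−(σ+iv)} Γ(σ+iv) Γ(σ+1+iv) dv`. [cite: KowalskiMichelVanderKam2000, (21) p. 12] -/
theorem cutoffW_eq_integral_vertical {σ : ℝ} (hσ : 0 < σ) {y : ℝ} (hy : 0 < y) :
    ((cutoffW y : ℝ) : ℂ) =
      (1 / (2 * π) : ℂ) * ∫ v : ℝ, (y : ℂ) ^ (-(σ + v * I)) *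
        (Complex.Gamma (σ + v * I) * Complex.Gamma (σ + v * I + 1)) := by
  rw [cutoffW_eq_mellinInv hσ hy, mellinInv, Complex.real_smul]
  push_cast
  rfl

/-! ### The double-integral form `W(y) = ∫_{v>y} ∫_{u>0} e^{−u−v/u} u⁻¹ du dv` -/

/-- For `u > 0`: `∫_{v > y} e^{−u−v/u} u⁻¹ dv = e^{−u−y/u}` (an exponential tail).
[cite: KowalskiMichelVanderKam2000, (21) p. 12] -/
theorem integral_Ioi_exp_neg_sub_div_div {u : ℝ} (hu : 0 < u) (y : ℝ) :
    ∫ v in Ioi y, Real.exp (-u - v / u) / u = Real.exp (-u - y / u) := by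
  have hpt : ∀ v : ℝ, Real.exp (-u - v / u) / u = Real.exp (-u) / u * Real.exp (-u⁻¹ * v) := by
    intro v
    rw [show -u - v / u = -u + -u⁻¹ * v by ring, Real.exp_add]
    ring
  simp_rw [hpt]
  rw [integral_const_mul, integral_exp_mul_Ioi (by simpa using hu) y,
    show -u - y / u = -u + -u⁻¹ * y by ring, Real.exp_add]
  field_simp

/-- For `u > 0`: `v ↦ e^{−u−v/u} u⁻¹` is integrable on `(y, ∞)`. [cite: KowalskiMichelVanderKam2000, (21) p. 12] -/
theorem integrableOn_exp_neg_sub_div_div {u : ℝ} (hu : 0 < u) (y : ℝ) :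
    IntegrableOn (fun v : ℝ ↦ Real.exp (-u - v / u) / u) (Ioi y) := by
  have h : IntegrableOn (fun v : ℝ ↦ Real.exp (-u) / u * Real.exp (-u⁻¹ * v)) (Ioi y) :=
    (integrableOn_exp_mul_Ioi (a := -u⁻¹) (by simpa using hu) y).const_mul (Real.exp (-u) / u)
  refine h.congr_fun (fun v _ ↦ ?_) measurableSet_Ioi
  rw [show -u - v / u = -u + -u⁻¹ * v by ring, Real.exp_add]
  ring

/-- The integrand `(v, u) ↦ e^{−u−v/u} u⁻¹` is integrable on `(y,∞) × (0,∞)` for `y ≥ 0`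
(Tonelli: the iterated integral is `∫_0^∞ e^{−u−y/u} du = W(y) ≤ 1`).
[cite: KowalskiMichelVanderKam2000, (21) p. 12] -/
theorem integrable_exp_neg_sub_div_div_prod {y : ℝ} (hy : 0 ≤ y) :
    Integrable (fun p : ℝ × ℝ ↦ Real.exp (-p.2 - p.1 / p.2) / p.2)
      ((volume.restrict (Ioi y)).prod (volume.restrict (Ioi (0 : ℝ)))) := by
  have hmeas : AEStronglyMeasurable (fun p : ℝ × ℝ ↦ Real.exp (-p.2 - p.1 / p.2) / p.2)
      ((volume.restrict (Ioi y)).prod (volume.restrict (Ioi (0 : ℝ)))) := by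
    rw [Measure.prod_restrict, ← Measure.volume_eq_prod]
    refine ContinuousOn.aestronglyMeasurable (fun p hp ↦ ?_) (measurableSet_Ioi.prod measurableSet_Ioi)
    have hp2 : p.2 ≠ 0 := ne_of_gt hp.2
    have h : ContinuousAt (fun p : ℝ × ℝ ↦ -p.2 - p.1 / p.2) p :=
      continuous_snd.continuousAt.neg.sub
        (continuous_fst.continuousAt.div continuous_snd.continuousAt hp2)
    exact ((Real.continuous_exp.continuousAt.comp h).div continuous_snd.continuousAt
      hp2).continuousWithinAt
  refine (integrable_prod_iff' hmeas).mpr ⟨?_, ?_⟩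
  · exact (ae_restrict_iff' measurableSet_Ioi).mpr
      (ae_of_all _ fun u hu ↦ integrableOn_exp_neg_sub_div_div hu y)
  · refine (integrableOn_exp_neg_sub_div hy).congr_fun (fun u hu ↦ ?_) measurableSet_Ioi
    have hu0 : (0 : ℝ) < u := hu
    simp only
    rw [← integral_Ioi_exp_neg_sub_div_div hu0 y]
    refine setIntegral_congr_fun measurableSet_Ioi fun v _ ↦ ?_
    rw [Real.norm_of_nonneg (div_nonneg (Real.exp_pos _).le hu0.le)]

/-- **Double-integral form of KMV's cut-off** (the crux sketch's `kmvW`): for `y ≥ 0`,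
`W(y) = ∫_{v > y} ∫_{u > 0} e^{−u−v/u} u⁻¹ du dv` (Fubini, then `∫_{v>y} e^{−v/u}u⁻¹ dv = e^{−y/u}`);
equivalently `W′(y) = −∫_0^∞ e^{−u−y/u} u⁻¹ du` with `W(∞) = 0`.
[cite: KowalskiMichelVanderKam2000, (21) p. 12] -/
theorem cutoffW_eq_integral_Ioi_integral_Ioi {y : ℝ} (hy : 0 ≤ y) :
    cutoffW y = ∫ v in Ioi y, ∫ u in Ioi (0 : ℝ), Real.exp (-u - v / u) / u := by
  rw [integral_integral_swap (f := fun (v u : ℝ) ↦ Real.exp (-u - v / u) / u)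
    (integrable_exp_neg_sub_div_div_prod hy), cutoffW]
  refine setIntegral_congr_fun measurableSet_Ioi fun u hu ↦ ?_
  exact (integral_Ioi_exp_neg_sub_div_div hu y).symm

end Literature.NumberTheory.LFunctions.KMV2000

end
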